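import Summits.BirchSwinnertonDyer.Rank1Residual.GaloisImage.KolyvaginLedgerAlgebra
import Literature.NumberTheory.EllipticCurves.Kim2026.ShaLengthRankZeroKuriharaDivisibilityBound
import HarnessLib

/-!
# The SHALLOW half of the (a′) assembly: a Kurihara-number certificate bounds the scalar of Kato's
# Kolyvagin system against the generator — `κ′_n = a·g_n`, `δ̃_n ≢ 0 (mod p^j)` ⟹ `p^{t+j} ∤ a`
# (team n1011, ROUTE-1 §20.4 (C20), sub-target R1-23, skeleton `cells/n1011/skel/T-R1-23.md` step
# S1; p18)

HONEST FRAMING (cell `b2b-bsdres`, run/shared/lean/b2b/bsd-rank1-residual/, verbatim in every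
file): the goal of the cell is to DELETE the COMBINATION-SHAPED residual classes of the
Birch–Swinnerton-Dyer formula for ALL analytic-rank `≤ 1` elliptic curves over `ℚ` — "full BSD
formula for every rank `≤ 1` curve in class `C`" assembled STRICTLY from published theorems — so
that the rank-`≤ 1` remainder becomes exactly the CONSTRUCTION-SHAPED classes, which are TYPED
(missing-input `Prop`s), NOT attempted. This is not "finishing BSD". Team n1011 (N10/N11, the
additive block `X4 ∧ p = 3`): research route; TOOL theorems (Kurihara-number bookkeeping), no
Galois object, no class theorem, nothing booked, no mark changed, no fact.

## What and why

In WITNESS currency (an additive group `A` — the global `H¹` —, an additive map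
`L : A → ℤ/p^K` — the dictionary's `Λ ∘ loc_{v_p}` —, Kato's derivative family `κ` and its
Mazur–Rubin correction `κ′`, levels = finite sets of primes `d` with `n(d) = ∏_{q ∈ d} N q`), the
clauses of the cell's Kato–Kurihara dictionary (p09, `KatoKuriharaDictionaryThreeAt`:
`L(κ_d) = u_d · p^t · δ̃_{n(d)}(ψ_d)` with per-level units and surjective discrete logarithms, and the
unitriangular bridge `κ′_d − κ_d ∈ ℤ-span{κ_c : c ⊊ d}`) turn a CERTIFICATE at a level `n` —
`δ̃_{n}^{(j)}(ψ₀) ≠ 0` for ONE choice of surjective logarithms mod `p^j`, `t + j ≤ K`, together with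
the vanishing of the proper sub-level numbers mod `p^j` (hypothesis (v) of R23_endshape, the empty
level included: `v ≥ j`) — into `L(κ′_n) ∉ (p^{t+j})`, hence, if `κ′_n = a · g_n`, into
`p^{t+j} ∤ a` (`not_pow_dvd_of_certificate`).  Inputs: the tree's level reduction of Kurihara
numbers (`Kim2026.castHom_kuriharaNumber`, `reduceLog_surjective`), their independence of `ψ` up to
units (`kuriharaNumber_eq_zero_iff_of_surjective`), and the ledger algebra
(`Ledger.apply_mem_iff_of_sub_mem_closure`, `Ledger.pow_mul_dvd_pow_add_mul_iff`).

References: C.-H. Kim, AJM 148 (2026) §1.4.3, Thm. 1.9 (6), Thm. 3.13 [Kim2022StructureSelmer];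
B. Mazur, K. Rubin, Mem. AMS 799 (2004) App. A (33) [MazurRubin2004]; M. Kurihara, Münster J. Math.
7 (2014) §1.1 [Kurihara2014].
-/

noncomputable section

open scoped Classical

namespace Summit.BirchSwinnertonDyer.Rank1Residual.GaloisImage.Shallow

open Literature.NumberTheory.EllipticCurves Literature.NumberTheory.EllipticCurves.Kim2026
open CongruenceSubgroup

variable {ι A : Type*} [AddCommGroup A] {p : ℕ} [hp : Fact p.Prime]
variable {M : ℕ} (f : CuspForm (Gamma0 M) 2)

/-- Prime factors of a product of distinct primes indexed by a finite set. [folklore] -/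
theorem primeFactors_prod_eq_image (N : ι → ℕ) (d : Finset ι) (hN : ∀ q ∈ d, (N q).Prime)
    (hinj : Set.InjOn N d) : (∏ q ∈ d, N q).primeFactors = d.image N := by
  rw [show ∏ q ∈ d, N q = ∏ ℓ ∈ d.image N, ℓ from
    (Finset.prod_image (f := fun ℓ : ℕ => ℓ) hinj).symm]
  exact Nat.primeFactors_prod (by simpa using hN)

/-- Surjectivity "at every `q ∈ d`" is surjectivity "at every prime factor of `n(d)`". [folklore] -/
theorem forall_primeFactors_of_forall_mem {m : ℕ} (N : ι → ℕ) (d : Finset ι)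
    (hN : ∀ q ∈ d, (N q).Prime) (hinj : Set.InjOn N d)
    {ψ : (ℓ : ℕ) → (ZMod ℓ)ˣ →* Multiplicative (ZMod m)}
    (hψ : ∀ q ∈ d, Function.Surjective (ψ (N q))) :
    ∀ ℓ ∈ (∏ q ∈ d, N q).primeFactors, Function.Surjective (ψ ℓ) := by
  intro ℓ hℓ
  rw [primeFactors_prod_eq_image N d hN hinj, Finset.mem_image] at hℓ
  obtain ⟨q, hq, rfl⟩ := hℓ
  exact hψ q hq

/-- **A dictionary value at a level whose Kurihara number vanishes mod `p^j` lies in `(p^{t+j})`.**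
If `L x = u · p^t · δ̃^{(K)}_n(ψ)` and the reduction `δ̃^{(j)}_n` vanishes for EVERY surjective
choice of logarithms mod `p^j`, then `p^{t+j} ∣ L x` in `ℤ/p^K`.
[cite: Kim2022StructureSelmer, §1.4.3 and §1.5.1 (PDF p. 7)] -/
theorem pow_dvd_of_dict_of_forall_eq_zero {K t j : ℕ} (n : ℕ) [NeZero n]
    (hden : ∀ a : ℕ, (ratPlusSymbol f ((a : ℚ) / n)).den.Coprime (p ^ K))
    (hjK : j ≤ K) {x : ZMod (p ^ K)} {u : (ZMod (p ^ K))ˣ}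
    {ψ : (ℓ : ℕ) → (ZMod ℓ)ˣ →* Multiplicative (ZMod (p ^ K))}
    (hψ : ∀ ℓ ∈ n.primeFactors, Function.Surjective (ψ ℓ))
    (hx : x = (u : ZMod (p ^ K)) * (p : ZMod (p ^ K)) ^ t * kuriharaNumber f (p ^ K) n ψ)
    (hzero : ∀ ψ' : (ℓ : ℕ) → (ZMod ℓ)ˣ →* Multiplicative (ZMod (p ^ j)),
      (∀ ℓ ∈ n.primeFactors, Function.Surjective (ψ' ℓ)) → kuriharaNumber f (p ^ j) n ψ' = 0) :
    ((p ^ (t + j) : ℕ) : ZMod (p ^ K)) ∣ x := by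
  have hdvd : p ^ j ∣ p ^ K := Nat.pow_dvd_pow p hjK
  have hred : kuriharaNumber f (p ^ j) n (reduceLog hdvd ψ) = 0 :=
    hzero _ (fun ℓ hℓ => reduceLog_surjective hdvd (hψ ℓ hℓ))
  have hcast : ZMod.castHom hdvd (ZMod (p ^ j)) (kuriharaNumber f (p ^ K) n ψ) = 0 := by
    rw [castHom_kuriharaNumber f hdvd n ψ hden, hred]
  obtain ⟨r, hr⟩ := pow_dvd_of_castHom_eq_zero hdvd _ hcast
  rw [hx, hr, pow_add, Nat.cast_mul, Nat.cast_pow]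
  exact ⟨(u : ZMod (p ^ K)) * r, by ring⟩

/-- **Conversely, a dictionary value whose Kurihara number is a certificate is NOT in `(p^{t+j})`**
(`t + j ≤ K`; the certificate for one surjective `ψ₀` mod `p^j` transfers to the dictionary's `ψ` by
the independence of the vanishing of `δ̃_n` from the logarithms).
[cite: Kim2022StructureSelmer, §1.4.3 (PDF p. 7)] [cite: Kurihara2014, §1.1 (PDF p. 2)] -/
theorem not_pow_dvd_of_dict_of_ne_zero {K t j : ℕ} (n : ℕ) [NeZero n]
    (hden : ∀ a : ℕ, (ratPlusSymbol f ((a : ℚ) / n)).den.Coprime (p ^ K))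
    (htj : t + j ≤ K) {x : ZMod (p ^ K)} {u : (ZMod (p ^ K))ˣ}
    {ψ : (ℓ : ℕ) → (ZMod ℓ)ˣ →* Multiplicative (ZMod (p ^ K))}
    (hψ : ∀ ℓ ∈ n.primeFactors, Function.Surjective (ψ ℓ))
    (hx : x = (u : ZMod (p ^ K)) * (p : ZMod (p ^ K)) ^ t * kuriharaNumber f (p ^ K) n ψ)
    {ψ₀ : (ℓ : ℕ) → (ZMod ℓ)ˣ →* Multiplicative (ZMod (p ^ j))}
    (hψ₀ : ∀ ℓ ∈ n.primeFactors, Function.Surjective (ψ₀ ℓ))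
    (hcert : kuriharaNumber f (p ^ j) n ψ₀ ≠ 0) :
    ¬ ((p ^ (t + j) : ℕ) : ZMod (p ^ K)) ∣ x := by
  intro h
  have hdvd : p ^ j ∣ p ^ K := Nat.pow_dvd_pow p (by omega)
  -- strip the unit and `p^t`
  rw [hx, mul_assoc] at h
  have h1 : ((p ^ (t + j) : ℕ) : ZMod (p ^ K)) ∣
      (p : ZMod (p ^ K)) ^ t * kuriharaNumber f (p ^ K) n ψ := (Units.dvd_mul_left (u := u)).mp h
  rw [← Nat.cast_pow] at h1
  have h2 := (Ledger.pow_mul_dvd_pow_add_mul_iff (p := p) htj _).1 h1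
  -- so the reduction mod `p^j` vanishes, for `reduceLog ψ`, hence for `ψ₀`
  have h3 : kuriharaNumber f (p ^ j) n (reduceLog hdvd ψ) = 0 := by
    rw [← castHom_kuriharaNumber f hdvd n ψ hden]
    obtain ⟨r, hr⟩ := h2
    rw [hr, map_mul, map_natCast, ZMod.natCast_self, zero_mul]
  have h4 := (kuriharaNumber_eq_zero_iff_of_surjective f (p ^ j) n hψ₀
    (fun ℓ hℓ => reduceLog_surjective hdvd (hψ ℓ hℓ))).1 h3
  exact hcert h4

/-- **The shallow half of (a′) (skeleton step S1): `p^{t+j} ∤ a`.**  Data: an additive group `A`,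
`L : A →+ ℤ/p^K`, families `κ κ′ : Finset ι → A`, a level `n`, prime labels `N` (distinct primes on
`n`), `N q ≠ 0`, the dictionary at every `d ⊆ n` (`L(κ_d) = u_d · p^t · δ̃^{(K)}_{n(d)}(ψ_d)`, surjective `ψ_d`),
the unitriangular bridge at `n`, `κ′_n = a · g`, `t + j ≤ K`, the `p`-integrality of the symbols,
the CERTIFICATE `δ̃^{(j)}_{n(n)}(ψ₀) ≠ 0` and the vanishing of `δ̃^{(j)}_{n(c)}` for every `c ⊊ n`
and every surjective choice (hypothesis (v); at `c = ∅` this is `v ≥ j`).  Then `L(κ′_n) ∉ (p^{t+j})`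
and `p^{t+j} ∤ a`. [cite: Kim2022StructureSelmer, Thm. 1.9 (6) and Thm. 3.13]
[cite: MazurRubin2004, App. A (33)] -/
theorem not_pow_dvd_of_certificate {K t j : ℕ} (L : A →+ ZMod (p ^ K))
    (κ κ' : Finset ι → A) (N : ι → ℕ) (n : Finset ι)
    (hN0 : ∀ q, N q ≠ 0) (hNp : ∀ q ∈ n, (N q).Prime) (hNinj : Set.InjOn N n)
    (hden : ∀ (m a : ℕ), (ratPlusSymbol f ((a : ℚ) / m)).den.Coprime (p ^ K))
    (hdict : ∀ d ⊆ n, ∃ (u : (ZMod (p ^ K))ˣ)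
      (ψ : (ℓ : ℕ) → (ZMod ℓ)ˣ →* Multiplicative (ZMod (p ^ K))),
      (∀ q ∈ d, Function.Surjective (ψ (N q))) ∧
        haveI : NeZero (∏ q ∈ d, N q) := ⟨Finset.prod_ne_zero_iff.2 fun q _ => hN0 q⟩
        L (κ d) = (u : ZMod (p ^ K)) * (p : ZMod (p ^ K)) ^ t *
          kuriharaNumber f (p ^ K) (∏ q ∈ d, N q) ψ)
    (hbr : κ' n - κ n ∈ AddSubgroup.closure {x | ∃ c, c ⊂ n ∧ x = κ c})
    {g : A} {a : ℕ} (hg : κ' n = a • g) (htj : t + j ≤ K)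
    {ψ₀ : (ℓ : ℕ) → (ZMod ℓ)ˣ →* Multiplicative (ZMod (p ^ j))}
    (hψ₀ : ∀ q ∈ n, Function.Surjective (ψ₀ (N q)))
    (hcert : haveI : NeZero (∏ q ∈ n, N q) := ⟨Finset.prod_ne_zero_iff.2 fun q _ => hN0 q⟩
      kuriharaNumber f (p ^ j) (∏ q ∈ n, N q) ψ₀ ≠ 0)
    (hv : ∀ c, c ⊂ n → ∀ ψ' : (ℓ : ℕ) → (ZMod ℓ)ˣ →* Multiplicative (ZMod (p ^ j)),
      (∀ q ∈ c, Function.Surjective (ψ' (N q))) →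
        haveI : NeZero (∏ q ∈ c, N q) := ⟨Finset.prod_ne_zero_iff.2 fun q _ => hN0 q⟩
        kuriharaNumber f (p ^ j) (∏ q ∈ c, N q) ψ' = 0) :
    L (κ' n) ∉ Ideal.span {((p ^ (t + j) : ℕ) : ZMod (p ^ K))} ∧ ¬ p ^ (t + j) ∣ a := by
  have hne : ∀ d : Finset ι, NeZero (∏ q ∈ d, N q) := fun d =>
    ⟨Finset.prod_ne_zero_iff.2 fun q _ => hN0 q⟩
  set J : Ideal (ZMod (p ^ K)) := Ideal.span {((p ^ (t + j) : ℕ) : ZMod (p ^ K))} with hJ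
  -- proper sub-levels go to `J`
  have hsub : ∀ c, c ⊂ n → L (κ c) ∈ J := by
    intro c hc
    haveI := hne c
    obtain ⟨u, ψ, hψ, hL⟩ := hdict c hc.1
    rw [hJ, Ideal.mem_span_singleton]
    refine pow_dvd_of_dict_of_forall_eq_zero f (∏ q ∈ c, N q) (hden _) (by omega)
      (forall_primeFactors_of_forall_mem N c (fun q hq => hNp q (hc.1 hq)) (hNinj.mono hc.1) hψ)
      hL ?_
    intro ψ' hψ'
    refine hv c hc ψ' ?_
    intro q hq
    exact hψ' (N q) (by
      rw [primeFactors_prod_eq_image N c (fun q hq => hNp q (hc.1 hq)) (hNinj.mono hc.1)]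
      exact Finset.mem_image_of_mem N hq)
  -- the level `n` itself does not
  have hmain : L (κ n) ∉ J := by
    haveI := hne n
    obtain ⟨u, ψ, hψ, hL⟩ := hdict n le_rfl
    rw [hJ, Ideal.mem_span_singleton]
    exact not_pow_dvd_of_dict_of_ne_zero f (∏ q ∈ n, N q) (hden _) htj
      (forall_primeFactors_of_forall_mem N n hNp hNinj hψ) hL
      (forall_primeFactors_of_forall_mem N n hNp hNinj hψ₀) hcert
  have hκ' : L (κ' n) ∉ J := fun h =>
    hmain ((Ledger.apply_mem_iff_of_sub_mem_closure L J κ κ' n hbr hsub).1 h)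
  refine ⟨hκ', ?_⟩
  rw [hg] at hκ'
  have ha := (Ledger.natCast_not_mem_of_apply_nsmul_not_mem L J g a hκ').1
  exact (Ledger.natCast_not_mem_span_pow_iff (p := p) (by omega) a).1 ha

/-- **The shallow half of (a′), with the `p`-integrality hypothesis restricted to the sub-levels of
`n`** (the form the assembly discharges: `[a/m]⁺` is `p`-integral for `m` prime to the level, and
Kolyvagin primes are prime to the level).  Same statement and proof as `not_pow_dvd_of_certificate`.  Data: an additive group `A`,
`L : A →+ ℤ/p^K`, families `κ κ′ : Finset ι → A`, a level `n`, prime labels `N` (distinct primes on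
`n`), `N q ≠ 0`, the dictionary at every `d ⊆ n` (`L(κ_d) = u_d · p^t · δ̃^{(K)}_{n(d)}(ψ_d)`, surjective `ψ_d`),
the unitriangular bridge at `n`, `κ′_n = a · g`, `t + j ≤ K`, the `p`-integrality of the symbols,
the CERTIFICATE `δ̃^{(j)}_{n(n)}(ψ₀) ≠ 0` and the vanishing of `δ̃^{(j)}_{n(c)}` for every `c ⊊ n`
and every surjective choice (hypothesis (v); at `c = ∅` this is `v ≥ j`).  Then `L(κ′_n) ∉ (p^{t+j})`
and `p^{t+j} ∤ a`. [cite: Kim2022StructureSelmer, Thm. 1.9 (6) and Thm. 3.13]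
[cite: MazurRubin2004, App. A (33)] -/
theorem not_pow_dvd_of_certificate_levelwise {K t j : ℕ} (L : A →+ ZMod (p ^ K))
    (κ κ' : Finset ι → A) (N : ι → ℕ) (n : Finset ι)
    (hN0 : ∀ q, N q ≠ 0) (hNp : ∀ q ∈ n, (N q).Prime) (hNinj : Set.InjOn N n)
    (hden : ∀ d ⊆ n, ∀ a : ℕ,
      (ratPlusSymbol f ((a : ℚ) / (∏ q ∈ d, N q : ℕ))).den.Coprime (p ^ K))
    (hdict : ∀ d ⊆ n, ∃ (u : (ZMod (p ^ K))ˣ)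
      (ψ : (ℓ : ℕ) → (ZMod ℓ)ˣ →* Multiplicative (ZMod (p ^ K))),
      (∀ q ∈ d, Function.Surjective (ψ (N q))) ∧
        haveI : NeZero (∏ q ∈ d, N q) := ⟨Finset.prod_ne_zero_iff.2 fun q _ => hN0 q⟩
        L (κ d) = (u : ZMod (p ^ K)) * (p : ZMod (p ^ K)) ^ t *
          kuriharaNumber f (p ^ K) (∏ q ∈ d, N q) ψ)
    (hbr : κ' n - κ n ∈ AddSubgroup.closure {x | ∃ c, c ⊂ n ∧ x = κ c})
    {g : A} {a : ℕ} (hg : κ' n = a • g) (htj : t + j ≤ K)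
    {ψ₀ : (ℓ : ℕ) → (ZMod ℓ)ˣ →* Multiplicative (ZMod (p ^ j))}
    (hψ₀ : ∀ q ∈ n, Function.Surjective (ψ₀ (N q)))
    (hcert : haveI : NeZero (∏ q ∈ n, N q) := ⟨Finset.prod_ne_zero_iff.2 fun q _ => hN0 q⟩
      kuriharaNumber f (p ^ j) (∏ q ∈ n, N q) ψ₀ ≠ 0)
    (hv : ∀ c, c ⊂ n → ∀ ψ' : (ℓ : ℕ) → (ZMod ℓ)ˣ →* Multiplicative (ZMod (p ^ j)),
      (∀ q ∈ c, Function.Surjective (ψ' (N q))) →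
        haveI : NeZero (∏ q ∈ c, N q) := ⟨Finset.prod_ne_zero_iff.2 fun q _ => hN0 q⟩
        kuriharaNumber f (p ^ j) (∏ q ∈ c, N q) ψ' = 0) :
    L (κ' n) ∉ Ideal.span {((p ^ (t + j) : ℕ) : ZMod (p ^ K))} ∧ ¬ p ^ (t + j) ∣ a := by
  have hne : ∀ d : Finset ι, NeZero (∏ q ∈ d, N q) := fun d =>
    ⟨Finset.prod_ne_zero_iff.2 fun q _ => hN0 q⟩
  set J : Ideal (ZMod (p ^ K)) := Ideal.span {((p ^ (t + j) : ℕ) : ZMod (p ^ K))} with hJ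
  -- proper sub-levels go to `J`
  have hsub : ∀ c, c ⊂ n → L (κ c) ∈ J := by
    intro c hc
    haveI := hne c
    obtain ⟨u, ψ, hψ, hL⟩ := hdict c hc.1
    rw [hJ, Ideal.mem_span_singleton]
    refine pow_dvd_of_dict_of_forall_eq_zero f (∏ q ∈ c, N q) (hden c hc.1) (by omega)
      (forall_primeFactors_of_forall_mem N c (fun q hq => hNp q (hc.1 hq)) (hNinj.mono hc.1) hψ)
      hL ?_
    intro ψ' hψ'
    refine hv c hc ψ' ?_
    intro q hq
    exact hψ' (N q) (by
      rw [primeFactors_prod_eq_image N c (fun q hq => hNp q (hc.1 hq)) (hNinj.mono hc.1)]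
      exact Finset.mem_image_of_mem N hq)
  -- the level `n` itself does not
  have hmain : L (κ n) ∉ J := by
    haveI := hne n
    obtain ⟨u, ψ, hψ, hL⟩ := hdict n le_rfl
    rw [hJ, Ideal.mem_span_singleton]
    exact not_pow_dvd_of_dict_of_ne_zero f (∏ q ∈ n, N q) (hden n le_rfl) htj
      (forall_primeFactors_of_forall_mem N n hNp hNinj hψ) hL
      (forall_primeFactors_of_forall_mem N n hNp hNinj hψ₀) hcert
  have hκ' : L (κ' n) ∉ J := fun h =>
    hmain ((Ledger.apply_mem_iff_of_sub_mem_closure L J κ κ' n hbr hsub).1 h)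
  refine ⟨hκ', ?_⟩
  rw [hg] at hκ'
  have ha := (Ledger.natCast_not_mem_of_apply_nsmul_not_mem L J g a hκ').1
  exact (Ledger.natCast_not_mem_span_pow_iff (p := p) (by omega) a).1 ha

end Summit.BirchSwinnertonDyer.Rank1Residual.GaloisImage.Shallow

end
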